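import Summits.NavierStokesRegularity.NavierStokesRegularity.Theses.AxisymmetricExtremality
import Summits.NavierStokesRegularity.NavierStokesRegularity.Theorems.AxisymmetricExtremalityAxisymmetricKatoGlobalStubSeregin2020TypeIIMoserD
import Summits.NavierStokesRegularity.NavierStokesRegularity.Theorems.AxisymmetricExtremalityAxisymmetricKatoGlobalStubSeregin2020TypeIIMoserIteration
import Summits.NavierStokesRegularity.NavierStokesRegularity.Theorems.AxisymmetricExtremalityAxisymmetricKatoGlobalStubSeregin2020TypeIIOffAxisRepr
import Literature.Analysis.FluidPDE.CKNTenThirdsInterpolation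
import HarnessLib

/-!
# Seregin 2020, proof of Thm 2.1, (2.6): the swirl of an axisymmetric suitable weak solution is
# essentially bounded on `Q(1/2)`

Helper toward the stub `stub_seregin2020TypeII` of the crux `AxisymmetricKatoGlobal` (= the named
fact `Literature.Analysis.FluidPDE.Seregin2020_axisymmetricSingularPoint_typeII`, G. Seregin,
Anal. Math. Phys. 10 (2020) Paper 46 = arXiv:2006.04140, Thm 2.1). The first half of the printed
proof (arXiv pp. 5–7) establishes, for a suitable weak solution `(v, q)` in the unit cylinder
`Q = 𝒞 × ]-1, 0[` of the class of Def. 1.3 with axisymmetric slices, the bound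
(2.6) `sup_{z ∈ Q(1/2)} |σ(z)| ≤ c(M)`, `σ = ϱ v_φ` the swirl, `M = 1 + ‖v‖_{L^{10/3}(Q(3/4))}`,
by a Moser iteration run off the axis of symmetry. All the pieces are in the tree (sibling
modules): the off-axis smooth representative `V` of `v` in the Seregin–Zajaczkowski class
(`exists_isSmoothAxisymmetricSolutionOn_offAxis`), the reverse Hölder inequalities (2.5)
(`swirl_moser_reverseHolder`, for `u = (1 + σ²)^{1/2} ≥ max(1, |σ|)` on the cylinders
`Q̄(ρ) = ]-ρ², 0[ × B̄(0, ρ)`), the start of the iteration (`swirl_moser_start_le`, Step I) and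
Moser's bookkeeping with Seregin's exponents `m_k = (4/3)^k` (`eLpNorm_top_le_of_moser_chain_fourThirds`).
This file assembles them:

* `lintegral_parabolicCylinder_one_rpow_tenThirds_lt_top` — `v ∈ L^{10/3}(Q_1(0))` for the class
  of Def. 1.3 (`L_{2,∞}` and `∇v ∈ L₂` on `Q ⊇ Q_1(0) = ]-1,0[ × B(0,1)`; Lemarié-Rieusset's
  scale-invariant embedding `exists_lintegral_tenThirds_backward_le`), so `M < ∞`;
* `ae_eq_restrict_of_ae_eq_offAxis` — a representative on `]-1, 0[ × (𝒞 ∖ axis)` is a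
  representative on every measurable part of `Q` (the axis is Lebesgue-null);
* `swirl_ae_bounded_half` — **(2.6)**: `|σ| ≤ c` a.e. on `parabolicCylinder (1/2) 0 ⊆ Q(1/2)`,
  in exactly the form consumed by `exists_ancientLimit_isAxisymmetric_swirl_le` ((2.8), the
  bounded swirl of the blow-up limit). Proof: (2.5) along `m = (4/3)^k`, `r = 1/2 + 2^{-(k+2)}`,
  `r₁ = 1/2 + 2^{-(k+1)}` (`k ≥ 1`; constants `4K(1 + ‖V‖_{L^{10/3}(Q̄(3/4))}) 2^k`), the level
  `k = 1` and Step I make `‖u‖_{L^{40/9}(Q̄(5/8))}` finite, the levels `k ≥ 2` feed the abstract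
  iteration on the cylinders `Q̄(r^{(k)})`, whose intersection contains `Q_{1/2}(0)`; finally
  `|σ| ≤ u` and `v = V` a.e.

## References

* G. Seregin, Anal. Math. Phys. 10 (2020), Paper 46 = arXiv:2006.04140, proof of Thm. 2.1,
  Steps I–III and (2.6) (arXiv pp. 6–7). [Seregin2020]
* P. G. Lemarié-Rieusset, *The Navier–Stokes problem in the 21st century* (2016), §13.9. [LemarieRieusset2016]
-/

-- the problem directory repeats the summit name (D-0017); core's `dupNamespace` linter fires
set_option linter.dupNamespace false

noncomputable section

open MeasureTheory Set Function Filter Topology TopologicalSpace Metric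
open scoped NNReal ENNReal

namespace Summit.NavierStokesRegularity.NavierStokesRegularity.Theorems.AxisymmetricKatoGlobal.EulerScaling

open Literature.Analysis.FluidPDE Literature.Analysis.FluidPDE.SereginZajaczkowski2007
  Literature.Analysis.FluidPDE.Seregin2020

/-! ### `v ∈ L^{10/3}(Q_1(0))` for the class of Def. 1.3 -/

/-- **`M < ∞`**: for `v ∈ L_{2,∞}(Q)` with weak spatial gradient `∇v ∈ L₂(Q)` on Seregin's unit
cylinder `Q = 𝒞 × ]-1, 0[`, `∬_{Q_1(0)} |v|^{10/3} < ∞` on the parabolic ball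
`Q_1(0) = ]-1, 0[ × B(0, 1) ⊆ Q` (Lemarié-Rieusset 2016, (13.18), scale-invariant form
`exists_lintegral_tenThirds_backward_le`: `∬_{Q_1} |v|^{10/3} ≤ K A(1)^{2/3}(A(1) + E(1))`, and
`A(1), E(1) < ∞` from the global classes). [cite: Seregin2020, proof of Thm 2.1, Step I ("M = ‖v‖_{10/3,Q(3/4)} + 1")] -/
theorem lintegral_parabolicCylinder_one_rpow_tenThirds_lt_top
    {u : ℝ → EuclideanSpace ℝ (Fin 3) → EuclideanSpace ℝ (Fin 3)}
    {G : ℝ → EuclideanSpace ℝ (Fin 3) → EuclideanSpace ℝ (Fin 3) →L[ℝ] EuclideanSpace ℝ (Fin 3)}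
    (hA : ∃ C : ℝ≥0, ∀ᵐ t ∂(volume.restrict (Ioo (-1 : ℝ) 0)),
      ∫⁻ x in SereginSverak2009.spaceCyl 0 1, ‖u t x‖ₑ ^ 2 ≤ C)
    (hG : HasWeakSpatialGradientOn (SereginSverak2009.parCylOpens 0 1) u G)
    (hE : ∫⁻ z in SereginSverak2009.parCyl 0 1, ENNReal.ofReal (frobeniusNormSq (G z.1 z.2)) < ∞) :
    ∫⁻ z in parabolicCylinder 1 (0 : ℝ × EuclideanSpace ℝ (Fin 3)), ‖u z.1 z.2‖ₑ ^ (10 / 3 : ℝ) < ∞ := by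
  obtain ⟨K, hK⟩ := exists_lintegral_tenThirds_backward_le
  have hsub : parabolicCylinder 1 (0 : ℝ × EuclideanSpace ℝ (Fin 3)) ⊆ SereginSverak2009.parCyl 0 1 :=
    parabolicCylinder_subset_parCyl 0 1
  have hQ : parabolicCylinderOpens 1 (0 : ℝ × EuclideanSpace ℝ (Fin 3)) ≤ SereginSverak2009.parCylOpens 0 1 :=
    fun z hz => hsub hz
  have hA₀ : cknAEss 1 (0 : ℝ × EuclideanSpace ℝ (Fin 3)) u ≠ ∞ := by
    obtain ⟨C, hC⟩ := hA
    have hQI : Ioo ((0 : ℝ × EuclideanSpace ℝ (Fin 3)).1 - 1 ^ 2) (0 : ℝ × EuclideanSpace ℝ (Fin 3)).1 =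
        Ioo (-1 : ℝ) 0 := by simp
    have hbound : ∀ᵐ t ∂(volume.restrict (Ioo (-1 : ℝ) 0)),
        (ENNReal.ofReal (1 : ℝ))⁻¹ * ∫⁻ x in ball (0 : ℝ × EuclideanSpace ℝ (Fin 3)).2 1, ‖u t x‖ₑ ^ 2 ≤ C := by
      filter_upwards [hC] with t ht
      rw [ENNReal.ofReal_one, inv_one, one_mul, Prod.snd_zero]
      exact (lintegral_mono_set (ball_subset_spaceCyl 0 1)).trans ht
    have : cknAEss 1 (0 : ℝ × EuclideanSpace ℝ (Fin 3)) u ≤ C := by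
      simp only [cknAEss, hQI]
      exact essSup_le_of_ae_le _ hbound
    exact ne_top_of_le_ne_top ENNReal.coe_ne_top this
  have hE₀ : cknE 1 (0 : ℝ × EuclideanSpace ℝ (Fin 3)) G ≠ ∞ := by
    rw [cknE, ENNReal.ofReal_one, inv_one, one_mul]
    exact (lt_of_le_of_lt (lintegral_mono_set hsub) hE).ne
  refine lt_of_le_of_lt (hK u G 0 1 one_pos (hG.mono hQ) hA₀ hE₀) ?_
  exact ENNReal.mul_lt_top (ENNReal.mul_lt_top (ENNReal.mul_lt_top ENNReal.coe_lt_top ENNReal.ofReal_lt_top)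
    (ENNReal.rpow_lt_top_of_nonneg (by norm_num) hA₀)) (ENNReal.add_lt_top.2 ⟨hA₀.lt_top, hE₀.lt_top⟩)

/-! ### Representatives off the axis are representatives -/

/-- If `u = V` a.e. on `]-1, 0[ × U` with `U ⊇ 𝒞 ∖ {ϱ = 0}`, then `u = V` a.e. on every measurable
`T ⊆ Q = 𝒞 × ]-1, 0[` (the axis `{ϱ = 0}` is Lebesgue-null in `ℝ³`). [folklore] -/
theorem ae_eq_restrict_of_ae_eq_offAxis {β : Type*} {u V : ℝ × EuclideanSpace ℝ (Fin 3) → β}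
    {U : Set (EuclideanSpace ℝ (Fin 3))} (hUm : MeasurableSet U)
    (hU : ∀ x ∈ SereginSverak2009.spaceCyl (0 : EuclideanSpace ℝ (Fin 3)) 1, cylRadius x ≠ 0 → x ∈ U)
    (hae : u =ᵐ[volume.restrict (Ioo (-1 : ℝ) 0 ×ˢ U)] V)
    {T : Set (ℝ × EuclideanSpace ℝ (Fin 3))} (hT : MeasurableSet T) (hTQ : T ⊆ SereginSverak2009.parCyl 0 1) :
    u =ᵐ[volume.restrict T] V := by
  have h1 : ∀ᵐ z ∂(volume : Measure (ℝ × EuclideanSpace ℝ (Fin 3))), z ∈ Ioo (-1 : ℝ) 0 ×ˢ U → u z = V z :=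
    (ae_restrict_iff' (measurableSet_Ioo.prod hUm)).1 hae
  have h2 : ∀ᵐ z ∂(volume : Measure (ℝ × EuclideanSpace ℝ (Fin 3))), cylRadius z.2 ≠ 0 := by
    have h0 : (volume : Measure (ℝ × EuclideanSpace ℝ (Fin 3)))
        (univ ×ˢ {x : EuclideanSpace ℝ (Fin 3) | cylRadius x = 0}) = 0 := by
      rw [Measure.volume_eq_prod, Measure.prod_prod, volume_setOf_cylRadius_eq_zero, mul_zero]
    filter_upwards [measure_eq_zero_iff_ae_notMem.1 h0] with z hz
    exact fun h => hz ⟨mem_univ _, h⟩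
  show ∀ᵐ z ∂(volume.restrict T), u z = V z
  rw [ae_restrict_iff' hT]
  filter_upwards [h1, h2] with z h1 h2 hz
  have hz' := hTQ hz
  refine h1 ⟨?_, hU z.2 hz'.2 h2⟩
  have := hz'.1
  simpa using this

/-! ### (2.6): the essential bound of the swirl on `Q(1/2)` -/

/-- **Seregin 2020, Thm 2.1, (2.6): the swirl of an axisymmetric suitable weak solution of the
class of Def. 1.3 is essentially bounded on `Q(1/2)`.** For a suitable weak solution `(v, q)` in
`Q = 𝒞 × ]-1, 0[` with `v ∈ L_{2,∞}(Q)`, `∇v ∈ L₂(Q)`, `q ∈ L_{3/2}(Q)` and axisymmetric slices,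
there is `c` with `|σ(z)| = |x'| |v_φ(z)| ≤ c` for a.e. `z ∈ Q_{1/2}(0) = ]-1/4, 0[ × B(0, 1/2)`
("`sup_{z∈Q(1/2)} σ(z) ≤ c(M)`", `M = ‖v‖_{10/3,Q(3/4)} + 1 < ∞`). Assembly of the Moser iteration:
off-axis smooth representative `V`, `V ∈ L^{10/3}(Q̄(3/4))`, the reverse Hölder inequalities (2.5)
along `m_k = (4/3)^k`, `r^{(k)} = 1/2 + 2^{-(k+1)}`, `k ≥ 1` (constants `4K M 2^k`), Step I at
`k = 1`, Moser's iteration from `k = 2` on `Q̄(r^{(k)}) ⊇ Q_{1/2}(0)`, `|σ| ≤ (1+σ²)^{1/2}`, and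
`v = V` a.e. [cite: Seregin2020, proof of Thm 2.1, (2.6)] -/
theorem swirl_ae_bounded_half :
    ∀ (u : ℝ → EuclideanSpace ℝ (Fin 3) → EuclideanSpace ℝ (Fin 3))
      (p : ℝ → EuclideanSpace ℝ (Fin 3) → ℝ)
      (G : ℝ → EuclideanSpace ℝ (Fin 3) → EuclideanSpace ℝ (Fin 3) →L[ℝ] EuclideanSpace ℝ (Fin 3)),
      IsSuitableWeakSolutionOn (SereginSverak2009.parCylOpens 0 1) 1 0 u p →
      (∃ C : ℝ≥0, ∀ᵐ t ∂(volume.restrict (Ioo (-1 : ℝ) 0)),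
        ∫⁻ x in SereginSverak2009.spaceCyl 0 1, ‖u t x‖ₑ ^ 2 ≤ C) →
      HasWeakSpatialGradientOn (SereginSverak2009.parCylOpens 0 1) u G →
      (∫⁻ z in SereginSverak2009.parCyl 0 1, ENNReal.ofReal (frobeniusNormSq (G z.1 z.2)) < ∞) →
      (∫⁻ z in SereginSverak2009.parCyl 0 1, ‖p z.1 z.2‖ₑ ^ (3 / 2 : ℝ) < ∞) →
      (∀ t ∈ Ioo (-1 : ℝ) 0, IsAxisymmetric (u t)) →
      (∀ t ∈ Ioo (-1 : ℝ) 0, IsAxisymmetricScalar (p t)) →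
      ∃ c : ℝ, ∀ᵐ z ∂(volume.restrict (parabolicCylinder (1 / 2) (0 : ℝ × EuclideanSpace ℝ (Fin 3)))),
        |swirl (u z.1) z.2| ≤ c := by
  intro u p G hsw hA hG hE hp hu_ax hp_ax
  -- (0) the off-axis region `]-1,0[ × (𝒞 ∖ axis)` and the smooth representative `V`
  set U : Set (EuclideanSpace ℝ (Fin 3)) :=
    SereginSverak2009.spaceCyl (0 : EuclideanSpace ℝ (Fin 3)) 1 ∩ {x | cylRadius x ≠ 0} with hUdef
  have hUo : IsOpen U :=
    (SereginSverak2009.isOpen_spaceCyl 0 1).inter (isOpen_ne_fun continuous_cylRadius continuous_const)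
  have hUrot : ∀ θ x, rotZ θ x ∈ U ↔ x ∈ U := fun θ x => by
    simp only [hUdef, mem_inter_iff, mem_setOf_eq, SereginSverak2009.mem_spaceCyl, sub_zero, cylRadius_rotZ,
      rotZ_apply_two]
  set S : Opens (ℝ × EuclideanSpace ℝ (Fin 3)) := ⟨Ioo (-1 : ℝ) 0 ×ˢ U, isOpen_Ioo.prod hUo⟩ with hSdef
  have hSU : (S : Set (ℝ × EuclideanSpace ℝ (Fin 3))) = Ioo (-1 : ℝ) 0 ×ˢ U := rfl
  obtain ⟨V, hV, hae⟩ := exists_isSmoothAxisymmetricSolutionOn_offAxis u p G hsw hA hG hE hp hu_ax hp_ax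
    (-1) 0 le_rfl le_rfl U hUo inter_subset_left (fun x hx => hx.2) hUrot S hSU
  have hSrot : ∀ θ : ℝ, ∀ z ∈ (S : Set (ℝ × EuclideanSpace ℝ (Fin 3))),
      stRot θ z ∈ (S : Set (ℝ × EuclideanSpace ℝ (Fin 3))) := fun θ z hz => ⟨hz.1, (hUrot θ z.2).2 hz.2⟩
  -- the radii `r^{(k)} = 1/2 + 2^{-(k+1)}`
  have hrad : ∀ k : ℕ, 1 ≤ k →
      (1 / 2 : ℝ) ≤ 1 / 2 + (1 / 2 : ℝ) ^ (k + 1 + 1) ∧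
      1 / 2 + (1 / 2 : ℝ) ^ (k + 1 + 1) < 1 / 2 + (1 / 2 : ℝ) ^ (k + 1) ∧
      1 / 2 + (1 / 2 : ℝ) ^ (k + 1) ≤ 3 / 4 ∧
      1 / 2 + (1 / 2 : ℝ) ^ (k + 1) - (1 / 2 + (1 / 2 : ℝ) ^ (k + 1 + 1)) = (1 / 2 : ℝ) ^ (k + 2) := by
    intro k hk
    have h0 : (0 : ℝ) < (1 / 2 : ℝ) ^ (k + 1 + 1) := by positivity
    have h1 : (1 / 2 : ℝ) ^ (k + 1 + 1) = (1 / 2 : ℝ) ^ (k + 1) * (1 / 2) := pow_succ _ _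
    have h2 : (1 / 2 : ℝ) ^ (k + 1) ≤ (1 / 2 : ℝ) ^ 2 :=
      pow_le_pow_of_le_one (by norm_num) (by norm_num) (by omega)
    refine ⟨by linarith, by nlinarith, ?_, ?_⟩
    · norm_num at h2 ⊢
      linarith
    · rw [show k + 2 = k + 1 + 1 from rfl]
      ring
  have hBU : ∀ k : ℕ, 1 ≤ k → ∀ x : EuclideanSpace ℝ (Fin 3), ‖x‖ ≤ 1 / 2 + (1 / 2 : ℝ) ^ (k + 1) →
      cylRadius x ≠ 0 → x ∈ U := fun k hk x hx hρ =>
    ⟨ball_subset_spaceCyl 0 1 (mem_ball_zero_iff.2 (by linarith [(hrad k hk).2.2.1])), hρ⟩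
  -- the cylinders `Q̄(r^{(k)})`
  set A : ℕ → Set (ℝ × EuclideanSpace ℝ (Fin 3)) := fun k =>
    Ioo (-(1 / 2 + (1 / 2 : ℝ) ^ (k + 1)) ^ 2) 0 ×ˢ closedBall (0 : EuclideanSpace ℝ (Fin 3)) (1 / 2 + (1 / 2 : ℝ) ^ (k + 1))
    with hAdef
  have hAsub : ∀ k, 1 ≤ k → A k ⊆ A 1 := fun k hk => by
    obtain ⟨h1, h2, h3, -⟩ := hrad k hk
    refine prod_mono (Ioo_subset_Ioo ?_ le_rfl) (closedBall_subset_closedBall ?_) <;> norm_num <;> nlinarith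
  have hA1Q : A 1 ⊆ parabolicCylinder 1 (0 : ℝ × EuclideanSpace ℝ (Fin 3)) := by
    rintro z ⟨hz1, hz2⟩
    rw [mem_closedBall_zero_iff] at hz2
    rw [mem_parabolicCylinder]
    simp only [Prod.fst_zero, Prod.snd_zero, dist_zero_right]
    norm_num at hz1 hz2 ⊢
    exact ⟨⟨by linarith [hz1.1], hz1.2⟩, by linarith⟩
  have hA1Q' : A 1 ⊆ SereginSverak2009.parCyl 0 1 := hA1Q.trans (parabolicCylinder_subset_parCyl 0 1)
  have hAm : ∀ k, MeasurableSet (A k) := fun k => measurableSet_Ioo.prod measurableSet_closedBall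
  -- `u = V` a.e. on `A 1`
  have hUm : MeasurableSet U := hUo.measurableSet
  have hUmem : ∀ x ∈ SereginSverak2009.spaceCyl (0 : EuclideanSpace ℝ (Fin 3)) 1, cylRadius x ≠ 0 → x ∈ U :=
    fun x hx hρ => ⟨hx, hρ⟩
  -- `M < ∞`: `V ∈ L^{10/3}(Q̄(3/4))`
  set I34 : ℝ≥0∞ := ∫⁻ q in A 1, ‖V q.1 q.2‖ₑ ^ (10 / 3 : ℝ) with hI34
  have hI34t : I34 ≠ ⊤ := by
    have haeA : ∀ᵐ q ∂(volume.restrict (A 1)), ‖V q.1 q.2‖ₑ ^ (10 / 3 : ℝ) = ‖u q.1 q.2‖ₑ ^ (10 / 3 : ℝ) := by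
      filter_upwards [ae_eq_restrict_of_ae_eq_offAxis hUm hUmem hae (hAm 1) hA1Q'] with q hq
      rw [show V q.1 q.2 = uncurry V q from rfl, ← hq]
      rfl
    rw [hI34, lintegral_congr_ae haeA]
    exact (lt_of_le_of_lt (lintegral_mono_set hA1Q) (lintegral_parabolicCylinder_one_rpow_tenThirds_lt_top hA hG hE)).ne
  -- (2.5) along the levels `k ≥ 1`
  obtain ⟨K, hK⟩ := swirl_moser_reverseHolder
  set f : ℝ × EuclideanSpace ℝ (Fin 3) → ℝ := fun q => Real.sqrt (1 + swirl (V q.1) q.2 ^ 2) with hfdef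
  have hfe : ∀ q, ‖f q‖ₑ = ENNReal.ofReal (Real.sqrt (1 + swirl (V q.1) q.2 ^ 2)) := fun q =>
    Real.enorm_eq_ofReal (Real.sqrt_nonneg _)
  set C : ℕ → ℝ≥0∞ := fun k => K * (1 + I34 ^ (3 / 10 : ℝ)) * 4 * 2 ^ k with hCdef
  have hstep : ∀ k : ℕ, 1 ≤ k →
      (∫⁻ q in A (k + 1), ‖f q‖ₑ ^ (10 / 3 * (4 / 3 : ℝ) ^ k)) ^ (3 / 10 : ℝ) ≤
        C k * (∫⁻ q in A k, ‖f q‖ₑ ^ (5 / 2 * (4 / 3 : ℝ) ^ k)) ^ (2 / 5 : ℝ) := by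
    intro k hk
    obtain ⟨h1, h2, h3, h4⟩ := hrad k hk
    have hm : (1 : ℝ) ≤ (4 / 3 : ℝ) ^ k := one_le_pow₀ (by norm_num)
    have h := hK V p S (-1) U hUo hSU hSrot (fun x hx => hx.2) hV ((4 / 3 : ℝ) ^ k)
      (1 / 2 + (1 / 2 : ℝ) ^ (k + 1 + 1)) (1 / 2 + (1 / 2 : ℝ) ^ (k + 1)) hm h1 h2 (by linarith)
      (by nlinarith) (hBU k hk)
    rw [← Measure.volume_eq_prod, h4] at h
    simp only [hfe]
    refine h.trans (mul_le_mul' ?_ le_rfl)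
    have h2k : (ENNReal.ofReal ((1 / 2 : ℝ) ^ (k + 2)))⁻¹ = 4 * 2 ^ k := by
      rw [one_div, inv_pow, ENNReal.ofReal_inv_of_pos (by positivity), inv_inv,
        ENNReal.ofReal_pow (by norm_num), ENNReal.ofReal_ofNat, pow_add]
      norm_num
      ring
    rw [div_eq_mul_inv, h2k, hCdef]
    simp only
    rw [← mul_assoc]
    gcongr K * (1 + ?_ ^ (3 / 10 : ℝ)) * 4 * 2 ^ k
    exact lintegral_mono_set (hAsub k hk)
  -- Step III: Moser's iteration on the cylinders `A k = Q̄(r^{(k)})`, `k ≥ 2`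
  set μ : Measure (ℝ × EuclideanSpace ℝ (Fin 3)) := volume.restrict (A 1) with hμ
  have hrestr : ∀ k, 1 ≤ k → μ.restrict (A k) = volume.restrict (A k) := fun k hk => by
    rw [hμ]
    exact Measure.restrict_restrict_of_subset (hAsub k hk)
  have Hchain : ∀ k, 2 ≤ k →
      eLpNorm f (ENNReal.ofReal (5 / 2 * (4 / 3 : ℝ) ^ (k + 1))) (μ.restrict (A (k + 1))) ≤
        C k ^ (1 / (4 / 3 : ℝ) ^ k) * eLpNorm f (ENNReal.ofReal (5 / 2 * (4 / 3 : ℝ) ^ k)) (μ.restrict (A k)) := by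
    intro k hk
    have hq1 : (0 : ℝ) < 5 / 2 * (4 / 3 : ℝ) ^ (k + 1) := by positivity
    have hq0 : (0 : ℝ) < 5 / 2 * (4 / 3 : ℝ) ^ k := by positivity
    rw [hrestr (k + 1) (by omega), hrestr k (by omega), eLpNorm_ofReal_eq_lintegral_rpow _ _ hq1,
      eLpNorm_ofReal_eq_lintegral_rpow _ _ hq0]
    have h := ENNReal.rpow_le_rpow (hstep k (by omega)) (by positivity : (0 : ℝ) ≤ 1 / (4 / 3 : ℝ) ^ k)
    rw [ENNReal.mul_rpow_of_nonneg _ _ (by positivity), ← ENNReal.rpow_mul, ← ENNReal.rpow_mul] at h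
    have e1 : (10 / 3 : ℝ) * (4 / 3 : ℝ) ^ k = 5 / 2 * (4 / 3 : ℝ) ^ (k + 1) := by ring
    have e2 : (3 / 10 : ℝ) * (1 / (4 / 3 : ℝ) ^ k) = 1 / (5 / 2 * (4 / 3 : ℝ) ^ (k + 1)) := by
      rw [mul_one_div, div_eq_div_iff (by positivity) (by positivity)]
      ring
    have e3 : (2 / 5 : ℝ) * (1 / (4 / 3 : ℝ) ^ k) = 1 / (5 / 2 * (4 / 3 : ℝ) ^ k) := by
      rw [mul_one_div, div_eq_div_iff (by positivity) (by positivity)]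
      ring
    rw [e1, e2, e3] at h
    exact h
  -- measurability of `u = (1 + σ²)^{1/2}` on `A 1` (continuous on `S`, the axis is null)
  have hfmeas : AEStronglyMeasurable f μ := by
    have e : μ = ((volume.restrict (Ioo (-(1 / 2 + (1 / 2 : ℝ) ^ (1 + 1)) ^ 2) 0)).prod
        (volume : Measure (EuclideanSpace ℝ (Fin 3)))).restrict
          (univ ×ˢ closedBall (0 : EuclideanSpace ℝ (Fin 3)) (1 / 2 + (1 / 2 : ℝ) ^ (1 + 1))) := by
      rw [hμ, Measure.volume_eq_prod, ← Measure.prod_restrict, ← Measure.prod_restrict, Measure.restrict_univ]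
    rw [e]
    refine (aemeasurable_prod_restrict_of_continuousOn_offAxis measurableSet_Ioo measurableSet_closedBall
      ?_).aestronglyMeasurable
    have hc : ContinuousOn f (S : Set (ℝ × EuclideanSpace ℝ (Fin 3))) :=
      Real.continuous_sqrt.comp_continuousOn (continuousOn_const.add (hV.continuousOn_swirl.pow 2))
    refine hc.mono ?_
    rintro q ⟨hq1, hq2, hq3⟩
    refine ⟨⟨lt_of_le_of_lt (by norm_num) hq1.1, hq1.2⟩, hBU 1 le_rfl _ (mem_closedBall_zero_iff.1 hq2) hq3⟩
  have hKt : K * (1 + I34 ^ (3 / 10 : ℝ)) * 4 ≠ ⊤ :=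
    ENNReal.mul_ne_top (ENNReal.mul_ne_top ENNReal.coe_ne_top
      (ENNReal.add_ne_top.2 ⟨ENNReal.one_ne_top, ENNReal.rpow_ne_top_of_nonneg (by norm_num) hI34t⟩)) (by norm_num)
  have hmain := eLpNorm_top_le_of_moser_chain_fourThirds hfmeas A hKt (by norm_num : (2 : ℝ≥0∞) ≠ ⊤) (C := C)
    (fun k _ => le_rfl) Hchain
  -- Step I and the level `k = 1`: `‖u‖_{L^{40/9}(A 2)} < ∞`
  have hstart : ∫⁻ q in A 1, ‖f q‖ₑ ^ (5 / 2 * (4 / 3 : ℝ)) < ⊤ := by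
    simp only [hfe]
    have h0 := swirl_moser_start_le V (r₁ := 1 / 2 + (1 / 2 : ℝ) ^ (1 + 1)) (by norm_num)
    rw [← Measure.volume_eq_prod] at h0
    refine lt_of_le_of_lt h0 (ENNReal.mul_lt_top (ENNReal.rpow_lt_top_of_nonneg (by norm_num) (by norm_num))
      (ENNReal.add_lt_top.2 ⟨?_, hI34t.lt_top⟩))
    rw [Measure.volume_eq_prod, Measure.prod_prod, Real.volume_Ioo]
    exact ENNReal.mul_lt_top ENNReal.ofReal_lt_top measure_closedBall_lt_top
  have hA2fin : eLpNorm f (ENNReal.ofReal (40 / 9)) (μ.restrict (A 2)) ≠ ⊤ := by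
    rw [hrestr 2 (by norm_num), eLpNorm_ofReal_eq_lintegral_rpow _ _ (by norm_num : (0 : ℝ) < 40 / 9)]
    refine ENNReal.rpow_ne_top_of_nonneg (by norm_num) ?_
    have h1 := hstep 1 le_rfl
    rw [pow_one, show (10 / 3 * (4 / 3) : ℝ) = 40 / 9 by norm_num] at h1
    have hfin : (∫⁻ q in A 2, ‖f q‖ₑ ^ (40 / 9 : ℝ)) ^ (3 / 10 : ℝ) < ⊤ := by
      refine lt_of_le_of_lt h1 (ENNReal.mul_lt_top ?_ (ENNReal.rpow_lt_top_of_nonneg (by norm_num) hstart.ne))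
      exact (ENNReal.mul_ne_top hKt (ENNReal.pow_ne_top ENNReal.ofNat_ne_top)).lt_top
    intro htop
    rw [htop, ENNReal.top_rpow_of_pos (by norm_num)] at hfin
    exact lt_irrefl _ hfin
  -- the essential bound of `u` on `⋂_j A (2 + j) ⊇ Q_{1/2}(0)`
  set B : ℝ≥0∞ := (K * (1 + I34 ^ (3 / 10 : ℝ)) * 4) ^ (9 / 4 : ℝ) * 2 ^ (45 / 4 : ℝ) *
    eLpNorm f (ENNReal.ofReal (40 / 9)) (μ.restrict (A 2)) with hB
  have hBt : B ≠ ⊤ :=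
    ENNReal.mul_ne_top (ENNReal.mul_ne_top (ENNReal.rpow_ne_top_of_nonneg (by norm_num) hKt)
      (ENNReal.rpow_ne_top_of_nonneg (by norm_num) ENNReal.ofNat_ne_top)) hA2fin
  have hae1 : ∀ᵐ z ∂(μ.restrict (⋂ j, A (2 + j))), f z ≤ B.toReal := by
    rw [eLpNorm_exponent_top] at hmain
    filter_upwards [ae_le_eLpNormEssSup (f := f) (μ := μ.restrict (⋂ j, A (2 + j)))] with z hz
    have hz' := hz.trans hmain
    rw [hfe z] at hz'
    exact (ENNReal.ofReal_le_iff_le_toReal hBt).1 hz'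
  have hIsub : (⋂ j, A (2 + j)) ⊆ A 1 := (iInter_subset _ 0).trans (hAsub 2 (by norm_num))
  have hPCsub : parabolicCylinder (1 / 2) (0 : ℝ × EuclideanSpace ℝ (Fin 3)) ⊆ ⋂ j, A (2 + j) := by
    refine subset_iInter fun j => ?_
    intro z hz
    rw [mem_parabolicCylinder] at hz
    obtain ⟨⟨hz1, hz2⟩, hz3⟩ := hz
    simp only [Prod.fst_zero, Prod.snd_zero] at hz1 hz2 hz3
    have hpos : (0 : ℝ) < (1 / 2 : ℝ) ^ (2 + j + 1) := by positivity
    have hle : (1 / 2 : ℝ) ^ (2 + j + 1) ≤ 1 / 2 := by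
      have : (1 / 2 : ℝ) ^ (2 + j + 1) ≤ (1 / 2 : ℝ) ^ 1 := pow_le_pow_of_le_one (by norm_num) (by norm_num) (by omega)
      simpa using this
    refine ⟨⟨by nlinarith, hz2⟩, ?_⟩
    rw [mem_closedBall]
    linarith
  have hae2 : ∀ᵐ z ∂(volume.restrict (parabolicCylinder (1 / 2) (0 : ℝ × EuclideanSpace ℝ (Fin 3)))),
      f z ≤ B.toReal := by
    have h := hae1
    rw [hμ, Measure.restrict_restrict_of_subset hIsub] at h
    exact ae_restrict_of_ae_restrict_of_subset hPCsub h
  -- back to `v`: `|σ| ≤ u`, `v = V` a.e. on `Q_{1/2}(0) ⊆ Q`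
  have hPCQ : parabolicCylinder (1 / 2) (0 : ℝ × EuclideanSpace ℝ (Fin 3)) ⊆ SereginSverak2009.parCyl 0 1 :=
    (parabolicCylinder_mono (by norm_num) (by norm_num : (1 : ℝ) / 2 ≤ 1) _).trans (parabolicCylinder_subset_parCyl 0 1)
  have hae3 : ∀ᵐ z ∂(volume.restrict (parabolicCylinder (1 / 2) (0 : ℝ × EuclideanSpace ℝ (Fin 3)))),
      uncurry u z = uncurry V z :=
    ae_eq_restrict_of_ae_eq_offAxis hUm hUmem hae (isOpen_parabolicCylinder _ _).measurableSet hPCQ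
  refine ⟨B.toReal, ?_⟩
  filter_upwards [hae2, hae3] with z h2 h3
  have h3' : u z.1 z.2 = V z.1 z.2 := h3
  calc |swirl (u z.1) z.2| = |swirl (V z.1) z.2| := by simp only [swirl, h3']
    _ ≤ Real.sqrt (1 + swirl (V z.1) z.2 ^ 2) := Real.abs_le_sqrt (by nlinarith)
    _ ≤ B.toReal := h2

end Summit.NavierStokesRegularity.NavierStokesRegularity.Theorems.AxisymmetricKatoGlobal.EulerScaling

end
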